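import Mathlib.LinearAlgebra.Dimension.Free
import Mathlib.LinearAlgebra.Dimension.Constructions
import Mathlib.SetTheory.Cardinal.Arithmetic
import Literature.AlgebraicGeometry.Motives.HodgeStructure
import Literature.AlgebraicGeometry.Motives.HodgeStructureOfComplexStructure
import Literature.AlgebraicGeometry.Motives.HodgeTensor
import HarnessLib

/-!
# Which `HodgeStructure V n` are inhabited (carrier witness for `Motives/HodgeStructure`)

`Literature.AlgebraicGeometry.Motives.HodgeStructure V n` (pure `ℚ`-Hodge structures of weight `n`
on the `ℚ`-vector space `V`, filtration form; Deligne, *Théorie de Hodge II*, 2.1.4/2.1.10) is the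
carrier over which the Kuga–Satake / K3 route items of the Hodge summit quantify
(`HodgeStructure T 2`, …). This file settles EXACTLY when it is inhabited:

* `HodgeStructure.nonempty_iff : Nonempty (HodgeStructure V n) ↔ Even n ∨ Even (finrank ℚ V)`,
* `HodgeStructure.isEmpty_iff  : IsEmpty (HodgeStructure V n) ↔ Odd n ∧ Odd (finrank ℚ V)`

(`Module.finrank ℚ V = 0`, even, for `V` of infinite dimension). Explicit inhabitants:

* even weight `n = 2k`, any `V`: the structure purely of type `(k, k)` (`HodgeStructure.pure`, the
  Tate-type structures of Deligne, Hodge II, 2.1.13) — `nonempty_of_even`, and the unconditional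
  instances in weights `0` and `2` (the weight of every example domain of the route items);
* odd weight `n = 2k + 1` on `V` of even or infinite dimension: `V ≃ W × W` carries the complex
  structure `J(a, b) = (-b, a)` (`rotate`, `exists_sq_eq_neg_of_even_finrank`); its real-ification
  is a complex structure on `V_ℝ` (`baseChange_baseChange_eq_neg`), whose weight-one Hodge structure
  `hodgeStructureOfCx` (`Motives/HodgeStructureOfComplexStructure`: `V_ℂ = V^{1,0} ⊕ conj V^{1,0}`,
  Carlson–Müller-Stach–Peters §3.5) Tate-twisted by `-k` (`HodgeStructure.tateTwist`, `cast`,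
  `Motives/HodgeTensor`) has weight `n` and types `(k+1, k), (k, k+1)` — `ofCxOdd`,
  `nonempty_of_sq_eq_neg`, `nonempty_of_even_finrank`, and the unconditional instances on `V × V`
  and on subsingleton `V` in every weight.

**The obstruction (a finding for the census):** in odd weight `n = 2k + 1` the opposedness axiom at
`(p, q) = (k + 1, k + 1)` reads `V_ℂ = F^{k+1} ⊕ conj F^{k+1}`, and `conj` is a conjugate-linear
bijection, so `dim_ℚ V = dim_ℂ V_ℂ = 2 dim_ℂ F^{k+1}` is even (`two_mul_finrank_F`; the linear
algebra of Voisin, *Hodge Theory I*, Cor. 6.13, "odd Betti numbers of compact Kähler manifolds are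
even"). Hence `HodgeStructure V n` is EMPTY for `n` odd and `dim_ℚ V` odd (`isEmpty_of_odd`,
e.g. `HodgeStructure ℚ 1`, `isEmpty_rat_one`): every statement quantified universally over such a
carrier is vacuous there. The same parity lemma is `HodgeStructure.even_finrank_of_odd` in
`Motives/MixedHodgeStructureOfPairProofs`; it is re-derived here in three lines from
`two_mul_hodgeNumber_ofSplitting` (`Motives/HodgeStructureWeil`) rather than imported, to keep this
carrier file inside the linear-algebraic Hodge-structure layer (that module's import cone is the
scheme-theoretic `SchemePair…` tower).

Everything is proved; no named fact is introduced.

## References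

* [DeligneHodgeII1971] P. Deligne, *Théorie de Hodge II*, Publ. Math. IHÉS 40 (1971), 1.2.5,
  2.1.4, 2.1.13.
* [VoisinHodgeI2002] C. Voisin, *Hodge Theory and Complex Algebraic Geometry I*, CUP 2002, §7.1.1
  and Cor. 6.13.
* [CarlsonMullerStachPeters2017] J. Carlson, S. Müller-Stach, C. Peters, *Period Mappings and
  Period Domains*, 2nd ed., §1.2 and §3.5 eq. (3.5).
-/

noncomputable section

open scoped TensorProduct

namespace Literature.AlgebraicGeometry.Motives

universe u v

variable {V : Type u} [AddCommGroup V] [Module ℚ V]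

namespace HodgeStructure

variable {n : ℤ}

/-! ### Even weight: the structures purely of type `(k, k)` -/

variable (V) in
/-- **Every `V` carries a Hodge structure of every even weight `n = 2k`**: the structure purely of
type `(k, k)` (`F^p = V_ℂ` for `p ≤ k`, `0` above; `HodgeStructure.pure`, Deligne, Hodge II, 2.1.13
on any `V`). [folklore] -/
theorem nonempty_of_even (hn : Even n) : Nonempty (HodgeStructure V n) := by
  obtain ⟨k, hk⟩ := hn
  exact ⟨pure V k n (by rw [hk, two_mul])⟩

/-! ### Complex structures on `ℚ`-vector spaces of even or infinite dimension -/

/-- The standard complex structure `(a, b) ↦ (-b, a)` on `W × W` (multiplication by `i` on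
`W ⊕ iW`). [folklore] -/
def rotate (W : Type v) [AddCommGroup W] [Module ℚ W] : (W × W) →ₗ[ℚ] (W × W) :=
  (-LinearMap.snd ℚ W W).prod (LinearMap.fst ℚ W W)

/-- `rotate (a, b) = (-b, a)`. [folklore] -/
@[simp]
theorem rotate_apply {W : Type v} [AddCommGroup W] [Module ℚ W] (x : W × W) :
    rotate W x = (-x.2, x.1) := rfl

/-- `rotate² = -1`. [folklore] -/
theorem rotate_rotate {W : Type v} [AddCommGroup W] [Module ℚ W] (x : W × W) :
    rotate W (rotate W x) = -x := by
  ext <;> simp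

/-- A complex structure transported along `V ≃ W × W`: `J = e⁻¹ ∘ rotate ∘ e` has `J² = -1`.
[folklore] -/
theorem exists_sq_eq_neg_of_linearEquiv {W : Type v} [AddCommGroup W] [Module ℚ W]
    (e : V ≃ₗ[ℚ] W × W) : ∃ J : V →ₗ[ℚ] V, ∀ v, J (J v) = -v :=
  ⟨e.symm.toLinearMap ∘ₗ rotate W ∘ₗ e.toLinearMap, fun v => by
    simp only [LinearMap.coe_comp, Function.comp_apply, LinearEquiv.coe_coe,
      LinearEquiv.apply_symm_apply, rotate_rotate, map_neg, LinearEquiv.symm_apply_apply]⟩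

/-- **A `ℚ`-vector space of even finite dimension, or of infinite dimension, carries a complex
structure** `J` (`J² = -1`): `V ≃ ℚᵏ × ℚᵏ` if `dim V = 2k`, and `V ≃ V × V` if `dim V = κ` is
infinite (`κ + κ = κ`); transport `rotate`. Recall `Module.finrank ℚ V = 0` for `V` of infinite
dimension, so the hypothesis reads "`dim V` even or infinite". [folklore] -/
theorem exists_sq_eq_neg_of_even_finrank (hV : Even (Module.finrank ℚ V)) :
    ∃ J : V →ₗ[ℚ] V, ∀ v, J (J v) = -v := by
  by_cases hfin : Module.Finite ℚ V
  · obtain ⟨k, hk⟩ := hV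
    exact exists_sq_eq_neg_of_linearEquiv (LinearEquiv.ofFinrankEq V ((Fin k → ℚ) × (Fin k → ℚ))
      (by rw [Module.finrank_prod, Module.finrank_fin_fun, hk]))
  · have hinf : Cardinal.aleph0 ≤ Module.rank ℚ V := by
      rw [← not_lt, Module.rank_lt_aleph0_iff]
      exact hfin
    exact exists_sq_eq_neg_of_linearEquiv (LinearEquiv.ofRankEq V (V × V)
      (by rw [rank_prod', Cardinal.add_eq_self hinf]))

/-- The real-ification `J_ℝ = id_ℝ ⊗ J` of a rational complex structure `J` on `V` is a complex
structure on `V_ℝ = ℝ ⊗_ℚ V`. [folklore] -/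
theorem baseChange_baseChange_eq_neg (J : V →ₗ[ℚ] V) (hJ : ∀ v, J (J v) = -v) (a : ℝ ⊗[ℚ] V) :
    J.baseChange ℝ (J.baseChange ℝ a) = -a := by
  induction a using TensorProduct.induction_on with
  | zero => simp
  | tmul r v => simp [hJ, TensorProduct.tmul_neg]
  | add x y hx hy => simp only [map_add, hx, hy, neg_add]

/-! ### Odd weight from a complex structure on `V_ℝ` -/

/-- **The Hodge structure of odd weight `n = 2k + 1` of a complex structure `J` on `V_ℝ`**: the
weight-one structure `hodgeStructureOfCx J hJ` (`V_ℂ = V^{1,0} ⊕ V^{0,1}`, `V^{1,0} = cxF1 J` the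
`-i`-eigenspace of `J_ℂ`, `V^{0,1}` its conjugate; Carlson–Müller-Stach–Peters §3.5 eq. (3.5))
Tate-twisted by `-k` (Deligne, Hodge II, 2.1.13: `F^p H(j) = F^{p+j} H`, weight `n - 2j`), i.e. the
same splitting with types relabelled `(k + 1, k)`, `(k, k + 1)`. The weight is a parameter `n` with
`n = 2k + 1` (transport by `HodgeStructure.cast`).
[cite: CarlsonMullerStachPeters2017, §3.5 eq. (3.5)] -/
def ofCxOdd (J : ℝ ⊗[ℚ] V →ₗ[ℝ] ℝ ⊗[ℚ] V) (hJ : ∀ a, J (J a) = -a) (k n : ℤ) (hn : n = 2 * k + 1) :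
    HodgeStructure V n :=
  ((hodgeStructureOfCx J hJ).tateTwist (-k)).cast (by omega)

/-- The Hodge filtration of `ofCxOdd`: the two-step filtration of `cxF1 J`, shifted by `k`.
[folklore] -/
theorem ofCxOdd_F (J : ℝ ⊗[ℚ] V →ₗ[ℝ] ℝ ⊗[ℚ] V) (hJ : ∀ a, J (J a) = -a) (k n : ℤ)
    (hn : n = 2 * k + 1) (p : ℤ) :
    (ofCxOdd J hJ k n hn).F p = twoStepFiltration (cxF1 J) 1 (p - k) := by
  rw [sub_eq_add_neg]
  rfl

/-- `F^{k+1} = V^{k+1,k} = cxF1 J` for `ofCxOdd`. [folklore] -/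
theorem ofCxOdd_F_succ (J : ℝ ⊗[ℚ] V →ₗ[ℝ] ℝ ⊗[ℚ] V) (hJ : ∀ a, J (J a) = -a) (k n : ℤ)
    (hn : n = 2 * k + 1) : (ofCxOdd J hJ k n hn).F (k + 1) = cxF1 J := by
  rw [ofCxOdd_F, add_sub_cancel_left]
  exact twoStepFiltration_of_pos_of_le _ one_pos le_rfl

/-- **A rational complex structure on `V` gives Hodge structures of every weight on `V`**: even
weights by `pure`, odd weights `2k + 1` by `ofCxOdd` applied to the real-ified complex structure.
[folklore] -/
theorem nonempty_of_sq_eq_neg (J : V →ₗ[ℚ] V) (hJ : ∀ v, J (J v) = -v) (n : ℤ) :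
    Nonempty (HodgeStructure V n) := by
  rcases Int.even_or_odd n with hn | ⟨k, hk⟩
  · exact nonempty_of_even V hn
  · exact ⟨ofCxOdd (J.baseChange ℝ) (baseChange_baseChange_eq_neg J hJ) k n hk⟩

/-- **`HodgeStructure V n` is inhabited in every weight as soon as `dim_ℚ V` is even or infinite**
(`Module.finrank ℚ V` even). [folklore] -/
theorem nonempty_of_even_finrank (hV : Even (Module.finrank ℚ V)) (n : ℤ) :
    Nonempty (HodgeStructure V n) := by
  obtain ⟨J, hJ⟩ := exists_sq_eq_neg_of_even_finrank hV
  exact nonempty_of_sq_eq_neg J hJ n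

/-! ### The obstruction: odd weight forces even dimension -/

/-- **In odd weight `n = 2k + 1`, `2 dim_ℂ F^{k+1} = dim_ℚ V`** (finite-dimensional `V`): the
opposedness axiom at `(k + 1, k + 1)` is the splitting `V_ℂ = F^{k+1} ⊕ conj F^{k+1}`, and
`dim conj F^{k+1} = dim F^{k+1}` (Hodge symmetry of the two-type structure `ofSplitting`,
`two_mul_hodgeNumber_ofSplitting`). This is the linear algebra of Voisin, *Hodge Theory I*,
Cor. 6.13. [cite: VoisinHodgeI2002, Cor. 6.13 (PDF p. 121)] -/
theorem two_mul_finrank_F [Module.Finite ℚ V] (H : HodgeStructure V n) (k : ℤ)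
    (hn : n = 2 * k + 1) : 2 * Module.finrank ℂ (H.F (k + 1)) = Module.finrank ℚ V := by
  have hc : IsCompl (H.F (k + 1)) (complexConj (H.F (k + 1))) :=
    H.isCompl_F_complexConj (k + 1) (k + 1) (by omega)
  have h := two_mul_hodgeNumber_ofSplitting (H.F (k + 1)) hc one_pos
  rwa [hodgeNumber_ofSplitting] at h

/-- **FINDING — `HodgeStructure V n` is EMPTY for `n` odd and `dim_ℚ V` odd** (e.g. there is no
`ℚ`-Hodge structure of weight `1` on `ℚ`): `dim_ℚ V = 2 dim_ℂ F^{k+1}` (`two_mul_finrank_F`;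
`V` is finite-dimensional since its `finrank` is positive). Every statement quantified universally
over `HodgeStructure V n` in this parameter region is vacuously true.
[cite: VoisinHodgeI2002, Cor. 6.13 (PDF p. 121)] -/
theorem isEmpty_of_odd (hn : Odd n) (hV : Odd (Module.finrank ℚ V)) :
    IsEmpty (HodgeStructure V n) := by
  refine ⟨fun H => ?_⟩
  haveI : Module.Finite ℚ V := Module.finite_of_finrank_pos hV.pos
  obtain ⟨k, hk⟩ := hn
  obtain ⟨m, hm⟩ := hV
  have h := H.two_mul_finrank_F k hk
  omega

/-- **Exact inhabitation region of the carrier `HodgeStructure V n`:** inhabited iff the weight is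
even or `dim_ℚ V` is even-or-infinite (`Module.finrank ℚ V` even).
[cite: VoisinHodgeI2002, Cor. 6.13 (PDF p. 121)] -/
theorem nonempty_iff : Nonempty (HodgeStructure V n) ↔ Even n ∨ Even (Module.finrank ℚ V) := by
  constructor
  · rintro ⟨H⟩
    rcases Int.even_or_odd n with hn | hn
    · exact Or.inl hn
    · rcases Nat.even_or_odd (Module.finrank ℚ V) with hV | hV
      · exact Or.inr hV
      · exact ((isEmpty_of_odd hn hV).false H).elim
  · rintro (hn | hV)
    exacts [nonempty_of_even V hn, nonempty_of_even_finrank hV n]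

/-- **Exact vacuity region of the carrier `HodgeStructure V n`:** empty iff the weight is odd and
`dim_ℚ V` is odd (in particular finite and positive).
[cite: VoisinHodgeI2002, Cor. 6.13 (PDF p. 121)] -/
theorem isEmpty_iff : IsEmpty (HodgeStructure V n) ↔ Odd n ∧ Odd (Module.finrank ℚ V) := by
  rw [← not_nonempty_iff, nonempty_iff, not_or, Int.not_even_iff_odd, Nat.not_even_iff_odd]

/-- The sharp example of the obstruction: **there is no `ℚ`-Hodge structure of weight `1` on `ℚ`**
(`dim = 1`). [cite: VoisinHodgeI2002, Cor. 6.13 (PDF p. 121)] -/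
theorem isEmpty_rat_one : IsEmpty (HodgeStructure ℚ 1) :=
  isEmpty_of_odd odd_one (by rw [Module.finrank_self]; exact odd_one)

/-! ### Unconditional instances -/

/-- Weight `2` (the weight of the K3 / Kuga–Satake carriers `HodgeStructure T 2`): inhabited on
every `V` by the structure purely of type `(1, 1)`. [folklore] -/
instance instNonemptyWeightTwo : Nonempty (HodgeStructure V 2) := ⟨pure V 1 2 (by norm_num)⟩

/-- Weight `0`: inhabited on every `V` by the trivial structure of type `(0, 0)` (`ofWeightZero`).
[folklore] -/
instance instNonemptyWeightZero : Nonempty (HodgeStructure V 0) := ⟨ofWeightZero V⟩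

/-- Every weight on `V × V` (complex structure `rotate`). [folklore] -/
instance instNonemptyProdSelf (n : ℤ) : Nonempty (HodgeStructure (V × V) n) :=
  nonempty_of_sq_eq_neg (rotate V) rotate_rotate n

/-- Every weight on the zero space (`finrank = 0`; all `F^p = 0 = V_ℂ`). [folklore] -/
instance instNonemptyOfSubsingleton [Subsingleton V] (n : ℤ) : Nonempty (HodgeStructure V n) :=
  nonempty_of_even_finrank (by rw [Module.finrank_zero_of_subsingleton]; exact Even.zero) n

end HodgeStructure

/-! ### The carrier-witness statements under the census names -/

/-- **Carrier witness for `HodgeStructure` (nonempty part).** `HodgeStructure V n` is inhabited for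
every `ℚ`-vector space `V` and weight `n` with `n` even or `dim_ℚ V` even-or-infinite — by the
explicit structures `HodgeStructure.pure` (even `n`) and `HodgeStructure.ofCxOdd` (odd `n`). The
hypothesis cannot be dropped: `HodgeStructure_isEmpty`.
[cite: VoisinHodgeI2002, Cor. 6.13 (PDF p. 121)] -/
theorem HodgeStructure_nonempty (V : Type u) [AddCommGroup V] [Module ℚ V] (n : ℤ)
    (h : Even n ∨ Even (Module.finrank ℚ V)) : Nonempty (HodgeStructure V n) :=
  HodgeStructure.nonempty_iff.2 h

/-- **Carrier witness for `HodgeStructure` (empty part, FINDING).** For `n` odd and `dim_ℚ V` odd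
(so `V ≠ 0` finite-dimensional) the type `HodgeStructure V n` is EMPTY: a Hodge structure of odd
weight `2k + 1` splits `V_ℂ = F^{k+1} ⊕ conj F^{k+1}` into two halves of equal dimension. Items
quantified universally over `HodgeStructure V n` in this region are vacuous.
[cite: VoisinHodgeI2002, Cor. 6.13 (PDF p. 121)] -/
theorem HodgeStructure_isEmpty (V : Type u) [AddCommGroup V] [Module ℚ V] (n : ℤ) (hn : Odd n)
    (hV : Odd (Module.finrank ℚ V)) : IsEmpty (HodgeStructure V n) :=
  HodgeStructure.isEmpty_of_odd hn hV

end Literature.AlgebraicGeometry.Motives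

end
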